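import Summits.QuantumFields.BalabanUV.T4Continuum.Support.VariationalGradientDuality
import Summits.QuantumFields.BalabanUV.T4Continuum.Support.VariationalVectorLandauTower
import Summits.QuantumFields.BalabanUV.T4Continuum.Support.VariationalVectorBochner

/-!
# T⁴ programme, spine node NE2 (U1a), lane P2 — leaf V-REG (1-forms), file 2/4: THE EULER–LAGRANGE OPERATOR OF THE ROAD'S VECTOR FORM
# `½·curlSq + G` IS FORM-BOUNDED AT THE CONSTRAINED MINIMISER over the fibre of the (1.18) line average `QvL T`, by multiplier-free UB-duality:
# `(n⁴/n^d)·Σ_{x,ν} |(½curl†curl W + ∇G W)_ν(x)|² ≤ Λ·ScV n M R G W` (k-UNIFORM; `Λ` = leaf V-UB's constant)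
# (`t4/skeletons/NE2-t4-ne2-p2.md` §2.E row V-REG «Euler–Lagrange; curvature commutators = plaquette defects»; cell `pub-balaban`, NE2 formalisation swarm,
# leaf prover 03 gen 5)

HONEST FRAMING (T4-DAG p. 1).  Rung (B)+1 only — NOT infinite volume, NOT a mass gap, NOT Clay.  NE2 is NOT IN PRINT and NOT proved here.  MODEL LEVEL,
`E = ℂ` (the vector END's carrier): bond transports `R : Tor (fine n M) → Fin d → (ℂ →L[ℂ] ℂ)`, line-indexed transports `T` of the (1.18) average
([Balaban1985AveragingOperations] (125) SHAPE, leaf-03-g4's `VectorLineTransport.QvL`), and the gauge∕curvature matrix `Gm` (road owner's decision (D2),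
`G = qform Gm ∘ unc`) are DATA (c5: no identification with Bałaban's `U(Γ)`, `R(U)`); lattice∕physical units as stated; ONE level.  What is proved is OURS
and elementary ([folklore]); nothing printed is a hypothesis; one data `def` (`elOpV`, the Euler–Lagrange operator); no `def … : Prop`; no `sorry`; axioms
standard.  HONEST DEPENDENCY (cell, verbatim): continuum YM on T⁴ ⇐ BetaPertH ∧ nine spine estimates (0/9 proved); BetaPertH ⇐ (D1) ∧ (D4) ∧ CAP+tail;
G-an2-4 gates asym, D1 and NE2/3/4.

INPUTS BY NAME.  File 1/3 `VariationalGradientDuality.nsq_mulVec_le_of_isMin` (this seat); the road owner's matrix presentation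
`VariationalVectorEffective.{unc, cur, Kcurl, KV, KV_posSemidef, ScV_eq_qform, nsq_unc}` (p216485); leaf-10-g3's averaging matrix `VariationalVectorTower.
{QmL, QmL_mulVec}` (p218948) and divergence matrix `VariationalVectorLandauTower.{divM, Kdiv, divM_mulVec}` (p220989); leaf-09-g6's Euler–Lagrange
operators `VariationalVectorBochner.{curlAdjCurlV, gradDivV, sum_ipv_curlAdjCurlV, sum_ipv_gradDivV}` (p219745); leaf-01-g5's V-AVG contraction
`VariationalVectorAverage.nsqV_QvL_le_qWV` (p218350).

CONTENTS.
 * §1 BRIDGES between the matrix world and the operator world at `E = ℂ`: a vector is determined by its pairings (`eq_of_forall_star_dotProduct`), and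
   **`Kcurl_mulVec_unc : Kcurl R *ᵥ unc W = 2 • unc (curlAdjCurlV R W)`**, **`Kdiv_mulVec_unc : Kdiv R *ᵥ unc W = unc (gradDivV R W)`** — the matrices of
   `curlSq` ∕ `divSq` ACT as leaf-09-g6's first-variation operators (their `sum_ipv_*` adjointness identities, read through `unc`);
 * §2 the EULER–LAGRANGE OPERATOR of `½·curlSq + qform Gm ∘ unc` in lattice units, `elOpV n M R Gm W x ν := curlAdjCurlV R W x ν + cur (Gm *ᵥ unc W) x ν`,
   and **`KV_mulVec_unc : KV n M R Gm *ᵥ unc W = (n²/n^d) • unc (elOpV n M R Gm W)`**;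
 * §3 **`physEl_le_of_isMin`** (THE END of this file): for `Gm` PSD, contractive line transports `‖T y j t μ‖ ≤ 1`, a V-UB binder
   `∀ φ, ∃ W, QvL T W = φ ∧ ScV R G W ≤ Λ·nsqV φ` (the END's `hUBc k`), and `W` minimising `ScV n M R G` on `{QvL T · = φ}`:
   `(n⁴/n^d)·nsqV (elOpV n M R Gm W) ≤ Λ·ScV n M R G W` — from file 1/4 with `K := KV`, `Q := QmL T`, `q = n^{−d}` (V-AVG).
   For the Feynman–Landau matrix `Gm = Kdiv R` the operator `elOpV` IS `curlAdjCurlV + gradDivV` (`elOpV_Kdiv`), the operator of leaf-09-g6's vector Bochner.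
File 3/4 (`VariationalVectorRegularityRho`) wires this into the END's `hREG k` binder for V-ONE-1F's `rhoV`.
-/

noncomputable section

open scoped BigOperators ComplexConjugate ComplexOrder Matrix InnerProductSpace

namespace Summit.QuantumFields.BalabanUV.T4Continuum.VariationalVectorRegularity

open Finset
open Literature.Analysis.Complex (qform)
open Literature.MathematicalPhysics.QuantumFieldTheory.Balaban1983to89.B5Prop11Plancherel (Tor fine unitVec)
open Literature.MathematicalPhysics.QuantumFieldTheory.Balaban1983to89.B5Prop11Lower (nsq nsq_nonneg star_dotProduct_self)
open Summit.QuantumFields.BalabanUV.T4Continuum.BalabanAveragedCoerciveFibre (star_dotProduct_conjTranspose_mulVec)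
open Summit.QuantumFields.BalabanUV.T4Continuum.VariationalGradientDuality (nsq_mulVec_le_of_isMin)
open Summit.QuantumFields.BalabanUV.T4Continuum.VariationalColourBochner (ipv)
open Summit.QuantumFields.BalabanUV.T4Continuum.VariationalVectorBochner (curlAdjCurlV gradDivV sum_ipv_curlAdjCurlV sum_ipv_gradDivV)
open Summit.QuantumFields.BalabanUV.T4Continuum.VariationalVectorWeitzenbock (divV)
open Summit.QuantumFields.BalabanUV.T4Continuum.VectorBlockTrialForm (nsqV nsqV_nonneg QvL)
open Summit.QuantumFields.BalabanUV.T4Continuum.VariationalVectorForm (curlV ScV qWV)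
open Summit.QuantumFields.BalabanUV.T4Continuum.VariationalVectorEffective
  (unc cur cur_unc unc_cur nsq_unc Kcurl curlM curlM_mulVec KV KV_posSemidef ScV_eq_qform)
open Summit.QuantumFields.BalabanUV.T4Continuum.VariationalVectorTower (QmL QmL_mulVec)
open Summit.QuantumFields.BalabanUV.T4Continuum.VariationalVectorLandauTower (divM Kdiv divM_mulVec)
open Summit.QuantumFields.BalabanUV.T4Continuum.VariationalVectorAverage (nsqV_QvL_le_qWV)
open Summit.QuantumFields.BalabanUV.T4Continuum.ScalarBlockPoincare (nsq_smul)

variable {d : ℕ}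

/-! ## §1 Bridges: the form matrices act as the first-variation operators -/

section Bridges

variable (N : Fin d → ℕ) [∀ μ, NeZero (N μ)]

omit [∀ μ, NeZero (N μ)] in
/-- a complex vector is determined by its pairings `v ↦ v†a`. [folklore] -/
theorem eq_of_forall_star_dotProduct {ι : Type*} [Fintype ι] {a b : ι → ℂ} (h : ∀ v : ι → ℂ, star v ⬝ᵥ a = star v ⬝ᵥ b) : a = b := by
  have h0 : star (a - b) ⬝ᵥ (a - b) = 0 := by rw [dotProduct_sub, h (a - b), sub_self]
  exact sub_eq_zero.mp (dotProduct_star_self_eq_zero.mp h0)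

omit [∀ μ, NeZero (N μ)] in
/-- the `star`-dot product as a sum of `conj · *`. [folklore] -/
theorem star_dotProduct_eq_sum {ι : Type*} [Fintype ι] (a b : ι → ℂ) : star a ⬝ᵥ b = ∑ i, conj (a i) * b i := rfl

/-- a field pairing at `E = ℂ`: `ipv g f = Σ conj(g)·f`. [folklore] -/
theorem ipv_eq_sum (g f : Tor N → ℂ) : ipv N g f = ∑ x, conj (g x) * f x := by
  unfold ipv
  exact sum_congr rfl fun x _ => RCLike.inner_apply' _ _

/-- at `E = ℂ` the colour pairing `ipv` of leaf-09-g4, summed over components, is the `star`-dot product of the uncurried vectors: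
`Σ_ν ipv (V·ν) (U·ν) = (unc V)† (unc U)`. [folklore] -/
theorem sum_ipv_eq_star_dotProduct (V U : Tor N → Fin d → ℂ) :
    ∑ ν, ipv N (fun y => V y ν) (fun y => U y ν) = star (unc V) ⬝ᵥ unc U := by
  rw [star_dotProduct_eq_sum, Fintype.sum_prod_type]
  simp only [ipv_eq_sum]
  exact Finset.sum_comm

/-- **THE CURL MATRIX ACTS AS leaf-09-g6's HODGE OPERATOR**: `Kcurl R *ᵥ unc W = 2 • unc (½curl†curl W)`, i.e. `curlMᴴ curlM` is twice `curlAdjCurlV`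
(by `sum_ipv_curlAdjCurlV`: `Σ_ν⟨V_ν, curlAdjCurlV W⟩ = ½·Σ⟨curl V, curl W⟩`). [folklore] -/
theorem Kcurl_mulVec_unc (R : Tor N → Fin d → (ℂ →L[ℂ] ℂ)) (W : Tor N → Fin d → ℂ) :
    Kcurl N R *ᵥ unc W = (2 : ℂ) • unc (curlAdjCurlV N R W) := by
  refine eq_of_forall_star_dotProduct fun v => ?_
  -- left: `v† curlMᴴ curlM (unc W) = (curlM v)† (curlM unc W) = Σ conj(curl (cur v))·curl W`
  have hL : star v ⬝ᵥ (Kcurl N R *ᵥ unc W) = ∑ μ, ∑ ν, ipv N (fun y => curlV N R (cur v) y μ ν) (fun y => curlV N R W y μ ν) := by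
    calc star v ⬝ᵥ (Kcurl N R *ᵥ unc W) = star (curlM N R *ᵥ v) ⬝ᵥ (curlM N R *ᵥ unc W) := by
          rw [Kcurl, ← Matrix.mulVec_mulVec, star_dotProduct_conjTranspose_mulVec]
      _ = ∑ p : Tor N × Fin d × Fin d, conj (curlV N R (cur v) p.1 p.2.1 p.2.2) * curlV N R W p.1 p.2.1 p.2.2 := by
          rw [star_dotProduct_eq_sum]
          refine sum_congr rfl fun p _ => ?_
          rw [curlM_mulVec, curlM_mulVec, cur_unc]
      _ = ∑ x, ∑ μ, ∑ ν, conj (curlV N R (cur v) x μ ν) * curlV N R W x μ ν := by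
          rw [Fintype.sum_prod_type]
          exact sum_congr rfl fun x _ => Fintype.sum_prod_type _
      _ = ∑ μ, ∑ ν, ∑ x, conj (curlV N R (cur v) x μ ν) * curlV N R W x μ ν :=
          Finset.sum_comm.trans (sum_congr rfl fun μ _ => Finset.sum_comm)
      _ = ∑ μ, ∑ ν, ipv N (fun y => curlV N R (cur v) y μ ν) (fun y => curlV N R W y μ ν) := by
          simp only [ipv_eq_sum]
  -- right: `v† (2 • unc (curlAdjCurlV W)) = 2·Σ_ν ipv (cur v ·ν) (curlAdjCurlV W ·ν)`
  have hR : star v ⬝ᵥ ((2 : ℂ) • unc (curlAdjCurlV N R W)) = 2 * ∑ ν, ipv N (fun y => cur v y ν) (fun y => curlAdjCurlV N R W y ν) := by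
    rw [dotProduct_smul, smul_eq_mul, sum_ipv_eq_star_dotProduct, unc_cur]
  rw [hL, hR, sum_ipv_curlAdjCurlV]; ring

/-- **THE DIVERGENCE-FORM MATRIX ACTS AS THE GRADIENT OF THE DIVERGENCE**: `Kdiv R *ᵥ unc W = unc (D div W)` (by `sum_ipv_gradDivV`:
`Σ_ν⟨V_ν, (D div W)_ν⟩ = ⟨div V, div W⟩`). [folklore] -/
theorem Kdiv_mulVec_unc (R : Tor N → Fin d → (ℂ →L[ℂ] ℂ)) (W : Tor N → Fin d → ℂ) :
    Kdiv N R *ᵥ unc W = unc (gradDivV N R W) := by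
  refine eq_of_forall_star_dotProduct fun v => ?_
  have hL : star v ⬝ᵥ (Kdiv N R *ᵥ unc W) = ipv N (divV N R (cur v)) (divV N R W) := by
    rw [Kdiv, ← Matrix.mulVec_mulVec, star_dotProduct_conjTranspose_mulVec, ipv_eq_sum, star_dotProduct_eq_sum]
    refine sum_congr rfl fun x _ => ?_
    rw [divM_mulVec, divM_mulVec, cur_unc]
  have hR : star v ⬝ᵥ unc (gradDivV N R W) = ∑ ν, ipv N (fun y => cur v y ν) (fun y => gradDivV N R W y ν) := by
    rw [sum_ipv_eq_star_dotProduct, unc_cur]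
  rw [hL, hR, sum_ipv_gradDivV]

end Bridges

/-! ## §2 The Euler–Lagrange operator of `½·curlSq + qform Gm ∘ unc` and the matrix `KV` -/

section EulerLagrange

variable (n : ℕ) [NeZero n] (M : Fin d → ℕ) [hM : ∀ μ, NeZero (M μ)]

/-- **the EULER–LAGRANGE OPERATOR** of the road's vector form `½·curlSq R W + G W` with `G = qform Gm ∘ unc` (lattice units):
`(E W)_ν(x) = (½curl†curl W)_ν(x) + (Gm · unc W)(x,ν)`. [folklore] -/
def elOpV (R : Tor (fine n M) → Fin d → (ℂ →L[ℂ] ℂ)) (Gm : Matrix (Tor (fine n M) × Fin d) (Tor (fine n M) × Fin d) ℂ)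
    (W : Tor (fine n M) → Fin d → ℂ) : Tor (fine n M) → Fin d → ℂ :=
  fun x ν => curlAdjCurlV (fine n M) R W x ν + cur (Gm *ᵥ unc W) x ν

/-- **`KV` ACTS AS `(n²/n^d)·elOpV`**: `KV n M R Gm *ᵥ unc W = (n²/n^d) • unc (elOpV n M R Gm W)`. [folklore] -/
theorem KV_mulVec_unc (R : Tor (fine n M) → Fin d → (ℂ →L[ℂ] ℂ)) (Gm : Matrix (Tor (fine n M) × Fin d) (Tor (fine n M) × Fin d) ℂ)
    (W : Tor (fine n M) → Fin d → ℂ) :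
    KV n M R Gm *ᵥ unc W = ((((n : ℝ) ^ 2 / (n : ℝ) ^ d : ℝ)) : ℂ) • unc (elOpV n M R Gm W) := by
  unfold KV
  rw [Matrix.smul_mulVec, Matrix.add_mulVec, Matrix.smul_mulVec, Kcurl_mulVec_unc, smul_smul]
  congr 1
  have h2 : ((((1 : ℝ) / 2 : ℝ)) : ℂ) * 2 = 1 := by push_cast; ring
  rw [h2, one_smul]
  funext p
  rfl

/-- for the Feynman–Landau matrix `Gm = Kdiv R` (leaf-10-g3's `KLandau 1`, up to the cast) the Euler–Lagrange operator IS leaf-09-g6's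
`curlAdjCurlV + gradDivV`, the operator of the vector Bochner inequality `hessianV_le_el`. [folklore] -/
theorem elOpV_Kdiv (R : Tor (fine n M) → Fin d → (ℂ →L[ℂ] ℂ)) (W : Tor (fine n M) → Fin d → ℂ) (x : Tor (fine n M)) (ν : Fin d) :
    elOpV n M R (Kdiv (fine n M) R) W x ν = curlAdjCurlV (fine n M) R W x ν + gradDivV (fine n M) R W x ν := by
  unfold elOpV
  rw [Kdiv_mulVec_unc, cur_unc]

/-- `Σ|unc U|² = nsqV U` on the fine torus (the road owner's `nsq_unc`, at the index `fine n M`). [folklore] -/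
theorem nsq_unc_fine (U : Tor (fine n M) → Fin d → ℂ) : nsq (unc U) = nsqV (fine n M) U := nsq_unc (fine n M) U

/-- the size of `KV · unc W` in terms of the Euler–Lagrange operator: `Σ|KV unc W|² = (n²/n^d)²·nsqV (elOpV W)`. [folklore] -/
theorem nsq_KV_mulVec_unc (R : Tor (fine n M) → Fin d → (ℂ →L[ℂ] ℂ)) (Gm : Matrix (Tor (fine n M) × Fin d) (Tor (fine n M) × Fin d) ℂ)
    (W : Tor (fine n M) → Fin d → ℂ) :
    nsq (KV n M R Gm *ᵥ unc W) = ((n : ℝ) ^ 2 / (n : ℝ) ^ d) ^ 2 * nsqV (fine n M) (elOpV n M R Gm W) := by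
  rw [KV_mulVec_unc, nsq_smul, nsq_unc_fine, Complex.norm_real, Real.norm_of_nonneg (by positivity)]

end EulerLagrange

/-! ## §3 The Euler–Lagrange operator is form-bounded at the constrained minimiser (multiplier-free UB-duality) -/

section Duality

variable (n : ℕ) [NeZero n] (M : Fin d → ℕ) [hM : ∀ μ, NeZero (M μ)]

/-- the V-AVG contraction in matrix letters: `Σ|QmL T v|² ≤ n^{−d}·Σ|v|²` for contractive line transports. [folklore] -/
theorem nsq_QmL_mulVec_le {T : Tor M → (Fin d → Fin n) → Fin n → Fin d → (ℂ →L[ℂ] ℂ)} (hT : ∀ y j t μ, ‖T y j t μ‖ ≤ 1)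
    (v : Tor (fine n M) × Fin d → ℂ) : nsq (QmL n M T *ᵥ v) ≤ ((n : ℝ) ^ d)⁻¹ * nsq v := by
  rw [QmL_mulVec, nsq_unc, ← unc_cur v, nsq_unc_fine, unc_cur]
  exact nsqV_QvL_le_qWV n M hT (cur v)

/-- the END's V-UB binder in matrix letters: `∀ ν, ∃ λ, QmL T λ = ν ∧ qform (KV R Gm) λ ≤ Λ·Σ|ν|²`. [folklore] -/
theorem ub_matrix {R : Tor (fine n M) → Fin d → (ℂ →L[ℂ] ℂ)} {Gm : Matrix (Tor (fine n M) × Fin d) (Tor (fine n M) × Fin d) ℂ}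
    {G : (Tor (fine n M) → Fin d → ℂ) → ℝ} (hG : ∀ W, G W = qform Gm (unc W)) {T : Tor M → (Fin d → Fin n) → Fin n → Fin d → (ℂ →L[ℂ] ℂ)} {Λ : ℝ}
    (hUBc : ∀ φ : Tor M → Fin d → ℂ, ∃ W, QvL n M T W = φ ∧ ScV n M R G W ≤ Λ * nsqV M φ) (ν : Tor M × Fin d → ℂ) :
    ∃ lam : Tor (fine n M) × Fin d → ℂ, QmL n M T *ᵥ lam = ν ∧ qform (KV n M R Gm) lam ≤ Λ * nsq ν := by
  obtain ⟨W, hW, hb⟩ := hUBc (cur ν)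
  refine ⟨unc W, ?_, ?_⟩
  · rw [QmL_mulVec, cur_unc, hW, unc_cur]
  · rw [← ScV_eq_qform n M R hG, ← unc_cur ν, nsq_unc]; exact hb

/-- **LEAF V-REG, EULER–LAGRANGE HALF (lattice units)**: at a constrained minimiser `W` of `ScV n M R G` (`G = qform Gm ∘ unc`, `Gm` PSD) on the fibre
`{W₂ : QvL T W₂ = φ}` of the (1.18) line average with CONTRACTIVE line transports, for every V-UB constant `Λ`,
`Σ |(KV · unc W)|² ≤ n^{−d}·Λ·ScV W`. [folklore] -/
theorem nsq_KV_mulVec_le_of_isMin {R : Tor (fine n M) → Fin d → (ℂ →L[ℂ] ℂ)} {Gm : Matrix (Tor (fine n M) × Fin d) (Tor (fine n M) × Fin d) ℂ}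
    (hGm : Gm.PosSemidef) {G : (Tor (fine n M) → Fin d → ℂ) → ℝ} (hG : ∀ W, G W = qform Gm (unc W))
    {T : Tor M → (Fin d → Fin n) → Fin n → Fin d → (ℂ →L[ℂ] ℂ)} (hT : ∀ y j t μ, ‖T y j t μ‖ ≤ 1) {Λ : ℝ} (hΛ : 0 ≤ Λ)
    (hUBc : ∀ φ : Tor M → Fin d → ℂ, ∃ W, QvL n M T W = φ ∧ ScV n M R G W ≤ Λ * nsqV M φ)
    {φ : Tor M → Fin d → ℂ} {W : Tor (fine n M) → Fin d → ℂ} (hW : QvL n M T W = φ)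
    (hmin : ∀ W₂, QvL n M T W₂ = φ → ScV n M R G W ≤ ScV n M R G W₂) :
    nsq (KV n M R Gm *ᵥ unc W) ≤ ((n : ℝ) ^ d)⁻¹ * Λ * ScV n M R G W := by
  have hw : QmL n M T *ᵥ unc W = unc φ := by rw [QmL_mulVec, cur_unc, hW]
  have hmin' : ∀ w', QmL n M T *ᵥ w' = unc φ → qform (KV n M R Gm) (unc W) ≤ qform (KV n M R Gm) w' := by
    intro w' hw'
    have hφ : QvL n M T (cur w') = φ := by
      have := congrArg cur hw'
      rwa [QmL_mulVec, cur_unc, cur_unc] at this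
    rw [← ScV_eq_qform n M R hG, ← unc_cur w', ← ScV_eq_qform n M R hG]
    exact hmin _ hφ
  have h := nsq_mulVec_le_of_isMin (KV n M R Gm) (KV_posSemidef n M R hGm) (QmL n M T) (by positivity) hΛ (nsq_QmL_mulVec_le n M hT)
    (ub_matrix n M hG hUBc) hw hmin'
  rwa [← ScV_eq_qform n M R hG] at h

/-- **LEAF V-REG, EULER–LAGRANGE HALF, PHYSICAL UNITS — THE END of file 2/4**: at a constrained minimiser `W` of the road's vector form on the fibre of
the (1.18) line average (contractive line transports `T`, `Gm` PSD, `G = qform Gm ∘ unc`), for every V-UB constant `Λ` (the END's `hUBc k`),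

  `(n⁴/n^d) · Σ_{x,ν} |(½curl†curl W)_ν(x) + (Gm·unc W)(x,ν)|² ≤ Λ · ScV n M R G W`

— the `L²`-norm² of the Euler–Lagrange operator in physical units is bounded by the action, UNIFORMLY in `n`, the torus and the background; no multiplier,
no KKT, no orthogonality of the rows of the average, no NE3. [folklore] -/
theorem physEl_le_of_isMin {R : Tor (fine n M) → Fin d → (ℂ →L[ℂ] ℂ)} {Gm : Matrix (Tor (fine n M) × Fin d) (Tor (fine n M) × Fin d) ℂ}
    (hGm : Gm.PosSemidef) {G : (Tor (fine n M) → Fin d → ℂ) → ℝ} (hG : ∀ W, G W = qform Gm (unc W))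
    {T : Tor M → (Fin d → Fin n) → Fin n → Fin d → (ℂ →L[ℂ] ℂ)} (hT : ∀ y j t μ, ‖T y j t μ‖ ≤ 1) {Λ : ℝ} (hΛ : 0 ≤ Λ)
    (hUBc : ∀ φ : Tor M → Fin d → ℂ, ∃ W, QvL n M T W = φ ∧ ScV n M R G W ≤ Λ * nsqV M φ)
    {φ : Tor M → Fin d → ℂ} {W : Tor (fine n M) → Fin d → ℂ} (hW : QvL n M T W = φ)
    (hmin : ∀ W₂, QvL n M T W₂ = φ → ScV n M R G W ≤ ScV n M R G W₂) :
    (n : ℝ) ^ 4 / (n : ℝ) ^ d * nsqV (fine n M) (elOpV n M R Gm W) ≤ Λ * ScV n M R G W := by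
  have hn : (0 : ℝ) < (n : ℝ) := by exact_mod_cast Nat.pos_of_ne_zero (NeZero.ne n)
  have hnd : (0 : ℝ) < (n : ℝ) ^ d := pow_pos hn d
  have h := nsq_KV_mulVec_le_of_isMin n M hGm hG hT hΛ hUBc hW hmin
  rw [nsq_KV_mulVec_unc] at h
  -- `(n²/n^d)²·X ≤ n^{−d}·Λ·S`  ⇔  `(n⁴/n^d)·X ≤ Λ·S`
  have e : (n : ℝ) ^ 4 / (n : ℝ) ^ d * nsqV (fine n M) (elOpV n M R Gm W)
      = (n : ℝ) ^ d * (((n : ℝ) ^ 2 / (n : ℝ) ^ d) ^ 2 * nsqV (fine n M) (elOpV n M R Gm W)) := by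
    field_simp
  rw [e]
  calc (n : ℝ) ^ d * (((n : ℝ) ^ 2 / (n : ℝ) ^ d) ^ 2 * nsqV (fine n M) (elOpV n M R Gm W))
      ≤ (n : ℝ) ^ d * (((n : ℝ) ^ d)⁻¹ * Λ * ScV n M R G W) := mul_le_mul_of_nonneg_left h hnd.le
    _ = Λ * ScV n M R G W := by field_simp

/-- **THE FEYNMAN–LANDAU INSTANCE** (`Gm = Kdiv R`, `G = divSq R ∘ …` via leaf-10-g3's `qform_Kdiv`): at the constrained minimiser,
`(n⁴/n^d)·Σ_{x,ν} |(½curl†curl W + D div W)_ν(x)|² ≤ Λ·ScV W` — exactly the quantity of leaf-09-g6's `sum_hessv_le_el`. [folklore] -/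
theorem physEl_le_of_isMin_div {R : Tor (fine n M) → Fin d → (ℂ →L[ℂ] ℂ)} {G : (Tor (fine n M) → Fin d → ℂ) → ℝ}
    (hG : ∀ W, G W = qform (Kdiv (fine n M) R) (unc W))
    {T : Tor M → (Fin d → Fin n) → Fin n → Fin d → (ℂ →L[ℂ] ℂ)} (hT : ∀ y j t μ, ‖T y j t μ‖ ≤ 1) {Λ : ℝ} (hΛ : 0 ≤ Λ)
    (hUBc : ∀ φ : Tor M → Fin d → ℂ, ∃ W, QvL n M T W = φ ∧ ScV n M R G W ≤ Λ * nsqV M φ)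
    {φ : Tor M → Fin d → ℂ} {W : Tor (fine n M) → Fin d → ℂ} (hW : QvL n M T W = φ)
    (hmin : ∀ W₂, QvL n M T W₂ = φ → ScV n M R G W ≤ ScV n M R G W₂) :
    (n : ℝ) ^ 4 / (n : ℝ) ^ d * ∑ x, ∑ ν, ‖curlAdjCurlV (fine n M) R W x ν + gradDivV (fine n M) R W x ν‖ ^ 2 ≤ Λ * ScV n M R G W := by
  have h := physEl_le_of_isMin n M (VariationalVectorLandauTower.Kdiv_posSemidef (fine n M) R) hG hT hΛ hUBc hW hmin
  have e : nsqV (fine n M) (elOpV n M R (Kdiv (fine n M) R) W) = ∑ x, ∑ ν, ‖curlAdjCurlV (fine n M) R W x ν + gradDivV (fine n M) R W x ν‖ ^ 2 := by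
    unfold nsqV
    exact sum_congr rfl fun x _ => sum_congr rfl fun ν _ => by rw [elOpV_Kdiv]
  rwa [e] at h

end Duality

end Summit.QuantumFields.BalabanUV.T4Continuum.VariationalVectorRegularity

end
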